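import Summits.NavierStokesRegularity.NavierStokesRegularity.Theorems.HeredityAtOne.Negative.SliceHeredityCap
import Summits.NavierStokesRegularity.FluidComputer.PalasekTowerBoxSchedule

/-!
# The rest design with readout radius `ρ`, and the KINEMATIC remainder of S⁺ with all design constants numeric

Cell `ns-blowup`, seat `refuter-ns-palasek-19249-disprove-1` (g2; DISPROVER, item stmt-NavierStokesRegularity-19249
`HeredityAtOne`). Companion of `SliceHeredityCap.lean` (same seat): NEGATIVE lane, sorry-free, no named fact, no
Navier–Stokes object constructed (the rest design is the trivial data `(0, 0)`; no stage, slice or flow). It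
names `restDesign ρ` — the box schedule (`Schedule.ofBox`: rigid window clock, `c₁ = 1`, `c₂ = 5/3`) with datum
`0`, force `0`, readout radius `ρ` (`HeredityAtOneZeroDesign.zeroDesign` is `ρ = 0`), pinned, rigid and quiet for
every `ρ` — and states the remainder of the design-free strengthening S⁺ = `SliceHeredityAtOne`
(`Cruxes/HeredityAtOne/StrategyCensus.lean` §2(e)) with every design constant NUMERIC
(`not_sliceHeredityAtOne_of_restDesign_slice`; S⁺ stated by its body, bridge `Iff.rfl`): ONE smooth divergence-free `H^∞` single-signed swirl-free slice
`v` (height `M`) with the level-1 letter read in `B̄(0, ρ)` (a point of speed `≥ Y₁ ≈ 2.78·10³`, a point of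
strain `≥ A₁ ≈ 1.2·10⁶`, an `N₁`-core loop, `N₁ = 256^{11/10} ≈ 445`, circulation `≥ N₁^{3/10} ≈ 6.2`), the
ceiling `‖v‖ ≤ (5/3) Y₁` everywhere, and Gallay–Šverák cap value `0.35356 · √(√((∫η)(∫r²η)) · M) < Y₂ ≈ 6.14·10³
= 2.2099 Y₁` refutes S⁺. Shape budget: `sup_B|v| / √(√((∫η)(∫r²η))·M) > 0.35356 · Y₁/Y₂ = 0.1600`; Hill's
spherical vortex gives `0.2048` (lab-frame centre speed `A a²/3`, cap value `1.6277 A a²`), a thin uniform-core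
ring only `1/(2√2 π) = 0.1125`. WHAT THIS IS NOT: S⁺ is a strengthening, not item 19249; no verdict change.
References: [cite: GallaySverak2016, Prop. 2.6 (2.14)]; [cite: LemarieRieusset2016, Thm. 10.4 (p. 285)];
[cite: Palasek2026ElementaryModel, §3.3, §4].
-/

noncomputable section

namespace Summit.NavierStokesRegularity.HeredityAtOneNoSwirlStratum

open Set MeasureTheory Filter Topology Function
open scoped ENNReal NNReal ContDiff
open Literature.Analysis.FluidPDE
open Summit.NavierStokesRegularity.FluidComputer
open Summit.NavierStokesRegularity.FluidComputer.PalasekTowerClayBridge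
open Summit.NavierStokesRegularity.NavierStokesRegularity
open Summit.NavierStokesRegularity.HeredityAtOneNoSwirlCap

/-! ## §4 The rest design with readout radius `ρ`: all design constants numeric -/

/-- **The rest design with readout radius `ρ`**: the box schedule (`Schedule.ofBox`: rigid window clock,
`c₁ = 1`, `c₂ = 5/3`) with datum `0`, force `0`, radius `ρ`, push constant `0` — pinned, rigid and quiet for
every `ρ`. (`HeredityAtOneZeroDesign.zeroDesign` is `ρ = 0`.) [cite: Palasek2026ElementaryModel, §3.3] -/
def restDesign (ρ : ℝ) : Schedule TowerRates.wide :=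
  Schedule.ofBox 0 0 ρ 0 zero_le_one contDiff_const HasCompactSupport.zero
    (by simpa only [show uncurry (0 : ℝ → EuclideanSpace ℝ (Fin 3) → EuclideanSpace ℝ (Fin 3)) =
      fun _ => 0 from rfl] using contDiff_const)
    (by simpa only [show uncurry (0 : ℝ → EuclideanSpace ℝ (Fin 3) → EuclideanSpace ℝ (Fin 3)) =
      (0 : ℝ × EuclideanSpace ℝ (Fin 3) → EuclideanSpace ℝ (Fin 3)) from rfl]
      using HasCompactSupport.zero)
    (fun _ _ _ => rfl) (fun _ _ _ => by simp)

/-- The rest design's floor constant is `1`. [folklore] -/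
@[simp] theorem restDesign_c₁ (ρ : ℝ) : (restDesign ρ).c₁ = 1 := rfl

/-- The rest design's ceiling constant is `5/3`. [folklore] -/
@[simp] theorem restDesign_c₂ (ρ : ℝ) : (restDesign ρ).c₂ = 5 / 3 := rfl

/-- The rest design's readout radius is `ρ`. [folklore] -/
@[simp] theorem restDesign_radius (ρ : ℝ) : (restDesign ρ).radius = ρ := rfl

/-- The rest design is RIGID. [folklore] -/
theorem restDesign_rigid (ρ : ℝ) : (restDesign ρ).Rigid := Schedule.ofBox_rigid _ _ _ _ _ _ _

/-- The rest design is QUIET. [folklore] -/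
theorem restDesign_quiet (ρ : ℝ) : (restDesign ρ).Quiet := Schedule.ofBox_quiet _ _ _ _ _ _ _

/-- The rest design is PINNED with `Λ = 8`, `θ = 6/5`. [folklore] -/
theorem restDesign_pins (ρ : ℝ) : (restDesign ρ).Pins 8 (6 / 5) :=
  Schedule.ofBox_pins _ _ _ _ _ _ _ (fun _ _ => rfl) (fun _ _ _ => rfl)

/-- **THE KINEMATIC REMAINDER OF S⁺, all constants numeric.** `SliceHeredityAtOne` is refuted by a readout
radius `ρ` and ONE smooth divergence-free `H^∞` single-signed swirl-free slice `v` (height `M`) carrying the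
level-1 letter of the rest design in `B̄(0, ρ)` (a point of speed `≥ Y₁`, a point of strain `≥ A₁`, an
`N₁`-core loop of circulation `≥ N₁^{β-2}`), obeying the ceiling `‖v‖ ≤ (5/3) Y₁` everywhere, with
Gallay–Šverák cap value `0.35356 · √(√((∫η)(∫r²η)) · M) < Y₂ = 2.2099… · Y₁`. Hill-type fat signed blobs meet
the speed/cap pair with ratio `0.2048 > 0.1600`; thin rings (`0.1125`) do not.
[cite: GallaySverak2016, Prop. 2.6 (2.14)] [cite: LemarieRieusset2016, Thm. 10.4 (p. 285)] [cite: Palasek2026ElementaryModel, §4] -/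
theorem not_sliceHeredityAtOne_of_restDesign_slice
    (hW : ∃ (ρ : ℝ) (v : EuclideanSpace ℝ (Fin 3) → EuclideanSpace ℝ (Fin 3)) (M : ℝ),
      ContDiff ℝ ∞ v ∧ VectorCalculus.IsDivFree v ∧ (∀ n : ℕ, ∫⁻ x, ‖iteratedFDeriv ℝ n v x‖ₑ ^ 2 < ⊤) ∧
      SignedNoSwirlSlice v M ∧ Letter (restDesign ρ) 1 v ∧
      (∀ x, ‖v x‖ ≤ 5 / 3 * TowerRates.wide.Y 1) ∧
      0.35356 * Real.sqrt (Real.sqrt ((∫ y, angVortQuot v y) *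
        ∫ y, cylRadius y ^ 2 * angVortQuot v y) * M) < TowerRates.wide.Y 2) :
    ¬ ∀ S : Schedule TowerRates.wide, S.Pins 8 (6 / 5) → S.Rigid → S.Quiet →
        ∀ v : EuclideanSpace ℝ (Fin 3) → EuclideanSpace ℝ (Fin 3),
          (Letter S 1 v ∧ ∀ x, ‖v x‖ ≤ S.c₂ * TowerRates.wide.Y 1) →
            SliceRun S 1 (fun S w => Letter S 2 w) v := by
  obtain ⟨ρ, v, M, hsm, hdiv, hH, hsl, hL, hceil, hlt⟩ := hW
  refine not_sliceHeredityAtOne_of_capped_signed_envelope_slice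
    ⟨restDesign ρ, v, M, restDesign_pins ρ, restDesign_rigid ρ, restDesign_quiet ρ, ?_, ⟨hL, ?_⟩,
      hsm, hdiv, hH, hsl, ?_⟩
  · rw [restDesign_c₁, restDesign_c₂]; norm_num
  · simpa only [restDesign_c₂] using hceil
  · simpa only [restDesign_c₁, one_mul] using hlt

end Summit.NavierStokesRegularity.HeredityAtOneNoSwirlStratum

end
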